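import Mathlib
import HarnessLib
import Summits.Ventures.LatticeQCDFlow.Scoring.RestartJarzynskiWeights
import Summits.Ventures.LatticeQCDFlow.Scoring.RestartTimeAverage

/-!
# The paired NE-MCMC difference along the restart chain: its autocovariances at every positive lag
# are the PRIOR chain's autocovariances of the DIFFERENCE of the two conditional Jarzynski means —
# so two protocols with the same conditional mean (e.g. two replicas of one protocol) give serially
# UNCORRELATED differences, however slow the prior chain

HONEST FRAMING: exact (Metropolis-corrected) sampling algorithms for lattice gauge theory;
figures of merit are autocorrelation/cost numbers at stated couplings and volumes; no
continuum-physics claim.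

Venture `LatticeQCDFlow` (cell pub-lqcd), topic `Scoring`; FANOUT row 8 (`s0-cpn-nemc` — S0-D2's
correlated-restart NE-MCMC protocol; Bonanno–Nada–Vadacchino 2024 NAMED ONLY — GEN-25).  NEW WORK of
the cell, not a published result; no definition is introduced; nothing is cited as a fact.
Companion of `Scoring/RestartChainPairedProtocolAgreement.lean` (the paired z-test) and of GEN-12's
`Scoring/RestartJarzynskiWeights.lean` (one protocol: the weight autocovariances ARE the prior
chain's autocovariances of the conditional Jarzynski mean `h(x) = ∫ e^{−W} dκF(x)`).  Row 13's
`Exactness/NCMCGeneralSpaceDilutionTotalVariance.lean` has the law of total variance of ONE record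
(`Var G = Var(E[G|start]) + E[Var(G|start)]`) and notes that replicas launched from the same start
estimate the second term; this file adds the SERIAL structure of the paired / replica difference
ALONG the restart chain (what its batch-means error bar sees).

THE OBJECTS.  A prior chain `κ₀` on `Ω` with invariant probability law `π₀`; two forward kernels
`κF : Kernel Ω E`, `κF' : Kernel Ω E'` (the non-equilibrium evolutions of two Crooks pairs
`(κF, κR, s, e, W)`, `(κF', κR', s', e', W')`, used here only through the measurability of the works
and work floors `W ≥ W_lo`, `W' ≥ W'_lo`); at each restart BOTH evolutions are launched from the
current prior configuration, independently given it: the restart chain of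
`Scoring/RestartChainAutocorrelation.lean` for the PRODUCT kernel `κF ×ₖ κF'`,
`K₂ = prodMkRight (E × E') κ₀ ⊗ₖ prodMkLeft (Ω × (E × E')) (κF ×ₖ κF')`, invariant law
`Π₂ = π₀ ⊗ₘ (κF ×ₖ κF')`.  The paired difference `D(x, ω, ω') = e^{−W(ω)} − e^{−W'(ω')}`; the two
conditional Jarzynski means `h(x) = ∫ e^{−W} dκF(x)`, `h'(x) = ∫ e^{−W'} dκF'(x)`.

* `integral_fst_kernelProd`, `integral_snd_kernelProd` (marginals of `κF ×ₖ κF'`);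
  **`condMean_pairedWeights`** — the conditional mean of `D − c` given the start is `h − h' − c`;
* **`restart_paired_autocov_succ`** — for every `t` and constant `c`:
  `autocov K₂ Π₂ (D − c) (t + 1) = autocov κ₀ π₀ (h − h' − c) (t + 1)` (GEN-12's
  `autocov_restart_succ` for the product kernel): along the paired run the prior chain enters ONLY
  through the autocorrelation of the DIFFERENCE of the two conditional means — the common-mode part
  of the two weight sequences cancels exactly, lag by lag; `restart_paired_autocov_succ_nHit` —
  the stride form (`κ₀ = nHit κ m`: lag `m (t + 1)` of `κ`);
* **`restart_paired_autocov_succ_eq_zero_of_condMean_eq`** — if `h = h'` pointwise then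
  `autocov K₂ Π₂ D (t + 1) = 0` for EVERY `t`: the paired differences are serially uncorrelated
  whatever the prior chain's autocorrelations;
* **`restart_replica_autocov_succ_eq_zero`** — in particular for two INDEPENDENT REPLICAS of ONE
  protocol from each start (`E' = E`, `κF' = κF`, `W' = W`);
* `restart_paired_condMeanDiff_sq_le` — lag `0`: `∫ (h − h' − c)² dπ₀ ≤ ∫ (D − c)² dΠ₂`
  (GEN-12's dilution inequality `autocov_restart_zero_ge`);
* `restart_paired_mean_eq` — `∫ D dΠ₂ = ∫ (h − h') dπ₀`;
* **`restart_paired_greenKubo_eq_sq_of_condMean_eq`**, **`restart_replica_greenKubo_eq_sq`** — if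
  `h = h'` (in particular for two replicas of one protocol) the Green–Kubo variance of `D` along `K₂`
  (the `σ²` of the paired CLT) IS the plain second moment `∫ D² dΠ₂`: the i.i.d. error bar of the
  replica difference is asymptotically exact however slow the prior chain;
* `integral_sq_sub_replicaProd`, **`restart_replica_sq_mean`** — and that second moment is
  `2 (∫ e^{−2W} dΠ − ∫ h² dπ₀) = 2 E_{π₀} Var(e^{−W} | x)`: the replica run measures the
  protocol-noise part of the S0-D2 error budget with an i.i.d.-exact error bar.

READING (value-free): the paired comparison on one stream sees the prior chain's slow modes only
through `h − h'`; two replicas per start give an uncorrelated difference sequence whose i.i.d.-exact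
second moment `2 E_{π₀} Var(e^{−W} | x)` is the protocol-noise part of the S0-D2 error budget (the
prior part is `σ²_{κ₀}(h)`, `RestartJarzynskiWeights`).  NOT CLAIMED: the lag-`0` decomposition for
two different protocols as an equality; `τ_int` corollaries for `h ≠ h'`; any number of ours.
-/

noncomputable section

namespace Summit.Ventures.LatticeQCDFlow.Scoring

open MeasureTheory ProbabilityTheory Filter Finset Preorder Set
open Summit.Ventures.LatticeQCDFlow.Exactness Summit.Ventures.LatticeQCDFlow.Exactness.GeneralNCMC
open scoped ENNReal Topology

section PairedAutocov

variable {Ω E E' : Type*} [MeasurableSpace Ω] [MeasurableSpace E] [MeasurableSpace E']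
  {ν₀ ν₁ : Measure Ω}
  {κF κR : Kernel Ω E} [IsMarkovKernel κF] [IsMarkovKernel κR] {s e : E → Ω} {W : E → ℝ}
  {κF' κR' : Kernel Ω E'} [IsMarkovKernel κF'] [IsMarkovKernel κR'] {s' e' : E' → Ω} {W' : E' → ℝ}
  {κ₀ : Kernel Ω Ω} [IsMarkovKernel κ₀]
  {π₀ : Measure Ω} [IsProbabilityMeasure π₀]

/-- First-path marginal of the product kernel: `∫ g(y.1) d(κF ×ₖ κF')(x) = ∫ g dκF(x)`. -/
theorem integral_fst_kernelProd (x : Ω) (g : E → ℝ) :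
    ∫ y, g y.1 ∂((κF ×ₖ κF') x) = ∫ y, g y ∂(κF x) := by
  rw [Kernel.prod_apply]
  have h := integral_prod_mul (μ := κF x) (ν := κF' x) (f := g) (g := fun _ : E' => (1 : ℝ))
  simp only [mul_one, integral_const, smul_eq_mul, probReal_univ] at h
  exact h

/-- Second-path marginal of the product kernel: `∫ g(y.2) d(κF ×ₖ κF')(x) = ∫ g dκF'(x)`. -/
theorem integral_snd_kernelProd (x : Ω) (g : E' → ℝ) :
    ∫ y, g y.2 ∂((κF ×ₖ κF') x) = ∫ y, g y ∂(κF' x) := by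
  rw [Kernel.prod_apply]
  have h := integral_prod_mul (μ := κF x) (ν := κF' x) (f := fun _ : E => (1 : ℝ)) (g := g)
  simp only [mul_one, one_mul, integral_const, smul_eq_mul, probReal_univ] at h
  exact h

omit [IsMarkovKernel κR] [IsMarkovKernel κR'] [IsMarkovKernel κ₀] [IsProbabilityMeasure π₀] in
/-- **The conditional mean of the (shifted) paired difference given the start is the (shifted)
difference of the two conditional Jarzynski means**: under work floors, for every constant `c`,
`x ↦ ∫ (e^{−W(y.1)} − e^{−W'(y.2)} − c) d(κF ×ₖ κF')(x) = h − h' − c`. -/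
theorem condMean_pairedWeights (h : CrooksPair ν₀ ν₁ κF κR s e W)
    (h' : CrooksPair ν₀ ν₁ κF' κR' s' e' W')
    {Wlo : ℝ} (hlo : ∀ ω, Wlo ≤ W ω) {Wlo' : ℝ} (hlo' : ∀ ω, Wlo' ≤ W' ω) (c : ℝ) :
    (fun x => ∫ y, (fun p : Ω × (E × E') => Real.exp (-W p.2.1) - Real.exp (-W' p.2.2) - c) (x, y)
        ∂((κF ×ₖ κF') x))
      = fun x => (∫ ω, Real.exp (-W ω) ∂(κF x)) - (∫ ω, Real.exp (-W' ω) ∂(κF' x)) - c := by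
  funext x
  have hg : Measurable fun ω : E => Real.exp (-W ω) := Real.measurable_exp.comp h.measurable_W.neg
  have hg' : Measurable fun ω : E' => Real.exp (-W' ω) :=
    Real.measurable_exp.comp h'.measurable_W.neg
  have i1 : Integrable (fun y : E × E' => Real.exp (-W y.1)) ((κF ×ₖ κF') x) :=
    integrable_of_bounded _ (hg.comp measurable_fst) (C := Real.exp (-Wlo)) fun y => by
      rw [abs_of_pos (Real.exp_pos _)]; exact Real.exp_le_exp.2 (neg_le_neg (hlo y.1))
  have i2 : Integrable (fun y : E × E' => Real.exp (-W' y.2)) ((κF ×ₖ κF') x) :=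
    integrable_of_bounded _ (hg'.comp measurable_snd) (C := Real.exp (-Wlo')) fun y => by
      rw [abs_of_pos (Real.exp_pos _)]; exact Real.exp_le_exp.2 (neg_le_neg (hlo' y.2))
  have i12 : Integrable (fun y : E × E' => Real.exp (-W y.1) - Real.exp (-W' y.2)) ((κF ×ₖ κF') x) :=
    i1.sub i2
  have e1 : ∫ y, Real.exp (-W y.1) ∂((κF ×ₖ κF') x) = ∫ ω, Real.exp (-W ω) ∂(κF x) :=
    integral_fst_kernelProd (κF := κF) (κF' := κF') x (fun ω => Real.exp (-W ω))
  have e2 : ∫ y, Real.exp (-W' y.2) ∂((κF ×ₖ κF') x) = ∫ ω, Real.exp (-W' ω) ∂(κF' x) :=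
    integral_snd_kernelProd (κF := κF) (κF' := κF') x (fun ω => Real.exp (-W' ω))
  show ∫ y, (Real.exp (-W y.1) - Real.exp (-W' y.2) - c) ∂((κF ×ₖ κF') x) = _
  rw [integral_sub i12 (integrable_const c), integral_sub i1 i2, integral_const,
    probReal_univ, one_smul, e1, e2]

omit [IsMarkovKernel κR] [IsMarkovKernel κR'] in
/-- **THE PAIRED DIFFERENCE'S AUTOCOVARIANCES ARE THE PRIOR CHAIN'S AUTOCOVARIANCES OF THE
DIFFERENCE OF CONDITIONAL MEANS**: under work floors, for every `t` and every constant `c`,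
`autocov K₂ Π₂ (D − c) (t + 1) = autocov κ₀ π₀ (h − h' − c) (t + 1)`. -/
theorem restart_paired_autocov_succ (h : CrooksPair ν₀ ν₁ κF κR s e W)
    (h' : CrooksPair ν₀ ν₁ κF' κR' s' e' W')
    {Wlo : ℝ} (hlo : ∀ ω, Wlo ≤ W ω) {Wlo' : ℝ} (hlo' : ∀ ω, Wlo' ≤ W' ω) (c : ℝ) (t : ℕ) :
    autocov ((Kernel.prodMkRight (E × E') κ₀) ⊗ₖ (Kernel.prodMkLeft (Ω × (E × E')) (κF ×ₖ κF')))
        (π₀ ⊗ₘ (κF ×ₖ κF')) (fun p => Real.exp (-W p.2.1) - Real.exp (-W' p.2.2) - c) (t + 1)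
      = autocov κ₀ π₀
        (fun x => (∫ ω, Real.exp (-W ω) ∂(κF x)) - (∫ ω, Real.exp (-W' ω) ∂(κF' x)) - c) (t + 1) := by
  have hGm : Measurable fun p : Ω × (E × E') => Real.exp (-W p.2.1) - Real.exp (-W' p.2.2) - c :=
    ((Real.measurable_exp.comp (h.measurable_W.comp (measurable_fst.comp measurable_snd)).neg).sub
      (Real.measurable_exp.comp (h'.measurable_W.comp (measurable_snd.comp measurable_snd)).neg)).sub
      measurable_const
  have hGb : ∀ p : Ω × (E × E'), |Real.exp (-W p.2.1) - Real.exp (-W' p.2.2) - c|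
      ≤ Real.exp (-Wlo) + Real.exp (-Wlo') + |c| := fun p => by
    have h1 : |Real.exp (-W p.2.1)| ≤ Real.exp (-Wlo) := by
      rw [abs_of_pos (Real.exp_pos _)]; exact Real.exp_le_exp.2 (neg_le_neg (hlo p.2.1))
    have h2 : |Real.exp (-W' p.2.2)| ≤ Real.exp (-Wlo') := by
      rw [abs_of_pos (Real.exp_pos _)]; exact Real.exp_le_exp.2 (neg_le_neg (hlo' p.2.2))
    exact (abs_sub _ _).trans (add_le_add ((abs_sub _ _).trans (add_le_add h1 h2)) le_rfl)
  rw [autocov_restart_succ hGm hGb t, condMean_pairedWeights h h' hlo hlo' c]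

omit [IsMarkovKernel κR] [IsMarkovKernel κR'] [IsMarkovKernel κ₀] in
/-- Stride form: with the prior chain run `m` sweeps between launches (`κ₀ = nHit κ m`),
`autocov K₂ Π₂ (D − c) (t + 1) = autocov κ π₀ (h − h' − c) (m (t + 1))`. -/
theorem restart_paired_autocov_succ_nHit (κ : Kernel Ω Ω) [IsMarkovKernel κ] (m : ℕ)
    (h : CrooksPair ν₀ ν₁ κF κR s e W) (h' : CrooksPair ν₀ ν₁ κF' κR' s' e' W')
    {Wlo : ℝ} (hlo : ∀ ω, Wlo ≤ W ω) {Wlo' : ℝ} (hlo' : ∀ ω, Wlo' ≤ W' ω) (c : ℝ) (t : ℕ) :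
    autocov ((Kernel.prodMkRight (E × E') (nHit κ m))
        ⊗ₖ (Kernel.prodMkLeft (Ω × (E × E')) (κF ×ₖ κF')))
        (π₀ ⊗ₘ (κF ×ₖ κF')) (fun p => Real.exp (-W p.2.1) - Real.exp (-W' p.2.2) - c) (t + 1)
      = autocov κ π₀
        (fun x => (∫ ω, Real.exp (-W ω) ∂(κF x)) - (∫ ω, Real.exp (-W' ω) ∂(κF' x)) - c)
        (m * (t + 1)) := by
  have hGm : Measurable fun p : Ω × (E × E') => Real.exp (-W p.2.1) - Real.exp (-W' p.2.2) - c :=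
    ((Real.measurable_exp.comp (h.measurable_W.comp (measurable_fst.comp measurable_snd)).neg).sub
      (Real.measurable_exp.comp (h'.measurable_W.comp (measurable_snd.comp measurable_snd)).neg)).sub
      measurable_const
  have hGb : ∀ p : Ω × (E × E'), |Real.exp (-W p.2.1) - Real.exp (-W' p.2.2) - c|
      ≤ Real.exp (-Wlo) + Real.exp (-Wlo') + |c| := fun p => by
    have h1 : |Real.exp (-W p.2.1)| ≤ Real.exp (-Wlo) := by
      rw [abs_of_pos (Real.exp_pos _)]; exact Real.exp_le_exp.2 (neg_le_neg (hlo p.2.1))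
    have h2 : |Real.exp (-W' p.2.2)| ≤ Real.exp (-Wlo') := by
      rw [abs_of_pos (Real.exp_pos _)]; exact Real.exp_le_exp.2 (neg_le_neg (hlo' p.2.2))
    exact (abs_sub _ _).trans (add_le_add ((abs_sub _ _).trans (add_le_add h1 h2)) le_rfl)
  rw [autocov_restart_succ_nHit κ m hGm hGb t, condMean_pairedWeights h h' hlo hlo' c]

omit [IsMarkovKernel κR] [IsMarkovKernel κR'] in
/-- **SAME CONDITIONAL MEAN ⇒ SERIALLY UNCORRELATED DIFFERENCES.**  If the two protocols have the same
conditional Jarzynski mean at every start (`h = h'`), then `autocov K₂ Π₂ D (t + 1) = 0` for every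
`t` — however slow the prior chain. -/
theorem restart_paired_autocov_succ_eq_zero_of_condMean_eq (h : CrooksPair ν₀ ν₁ κF κR s e W)
    (h' : CrooksPair ν₀ ν₁ κF' κR' s' e' W')
    {Wlo : ℝ} (hlo : ∀ ω, Wlo ≤ W ω) {Wlo' : ℝ} (hlo' : ∀ ω, Wlo' ≤ W' ω)
    (hhh' : ∀ x, ∫ ω, Real.exp (-W ω) ∂(κF x) = ∫ ω, Real.exp (-W' ω) ∂(κF' x)) (t : ℕ) :
    autocov ((Kernel.prodMkRight (E × E') κ₀) ⊗ₖ (Kernel.prodMkLeft (Ω × (E × E')) (κF ×ₖ κF')))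
        (π₀ ⊗ₘ (κF ×ₖ κF')) (fun p => Real.exp (-W p.2.1) - Real.exp (-W' p.2.2)) (t + 1) = 0 := by
  have key := restart_paired_autocov_succ (κ₀ := κ₀) (π₀ := π₀) h h' hlo hlo' 0 t
  simp only [sub_zero] at key
  rw [key]
  have hz : (fun x => (∫ ω, Real.exp (-W ω) ∂(κF x)) - ∫ ω, Real.exp (-W' ω) ∂(κF' x))
      = fun _ => (0 : ℝ) := funext fun x => by rw [hhh' x, sub_self]
  rw [hz]
  simp [autocov]

omit [IsMarkovKernel κR] in
/-- **THE REPLICA TRICK**: two INDEPENDENT evolutions of ONE protocol from each start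
(`κF ×ₖ κF`) — the differences of the two weights are serially uncorrelated at every positive lag. -/
theorem restart_replica_autocov_succ_eq_zero (h : CrooksPair ν₀ ν₁ κF κR s e W)
    {Wlo : ℝ} (hlo : ∀ ω, Wlo ≤ W ω) (t : ℕ) :
    autocov ((Kernel.prodMkRight (E × E) κ₀) ⊗ₖ (Kernel.prodMkLeft (Ω × (E × E)) (κF ×ₖ κF)))
        (π₀ ⊗ₘ (κF ×ₖ κF)) (fun p => Real.exp (-W p.2.1) - Real.exp (-W p.2.2)) (t + 1) = 0 :=
  restart_paired_autocov_succ_eq_zero_of_condMean_eq (κ₀ := κ₀) (π₀ := π₀) h h hlo hlo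
    (fun _ => rfl) t

omit [IsMarkovKernel κR] [IsMarkovKernel κR'] in
/-- Lag `0` (dilution): `∫ (h − h' − c)² dπ₀ ≤ ∫ (D − c)² dΠ₂` — the second moment of the shifted
difference of conditional means never exceeds that of the shifted paired difference. -/
theorem restart_paired_condMeanDiff_sq_le (h : CrooksPair ν₀ ν₁ κF κR s e W)
    (h' : CrooksPair ν₀ ν₁ κF' κR' s' e' W')
    {Wlo : ℝ} (hlo : ∀ ω, Wlo ≤ W ω) {Wlo' : ℝ} (hlo' : ∀ ω, Wlo' ≤ W' ω) (c : ℝ) :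
    ∫ x, ((∫ ω, Real.exp (-W ω) ∂(κF x)) - (∫ ω, Real.exp (-W' ω) ∂(κF' x)) - c) ^ 2 ∂π₀
      ≤ ∫ p, (Real.exp (-W p.2.1) - Real.exp (-W' p.2.2) - c) ^ 2 ∂(π₀ ⊗ₘ (κF ×ₖ κF')) := by
  have hGm : Measurable fun p : Ω × (E × E') => Real.exp (-W p.2.1) - Real.exp (-W' p.2.2) - c :=
    ((Real.measurable_exp.comp (h.measurable_W.comp (measurable_fst.comp measurable_snd)).neg).sub
      (Real.measurable_exp.comp (h'.measurable_W.comp (measurable_snd.comp measurable_snd)).neg)).sub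
      measurable_const
  have hGb : ∀ p : Ω × (E × E'), |Real.exp (-W p.2.1) - Real.exp (-W' p.2.2) - c|
      ≤ Real.exp (-Wlo) + Real.exp (-Wlo') + |c| := fun p => by
    have h1 : |Real.exp (-W p.2.1)| ≤ Real.exp (-Wlo) := by
      rw [abs_of_pos (Real.exp_pos _)]; exact Real.exp_le_exp.2 (neg_le_neg (hlo p.2.1))
    have h2 : |Real.exp (-W' p.2.2)| ≤ Real.exp (-Wlo') := by
      rw [abs_of_pos (Real.exp_pos _)]; exact Real.exp_le_exp.2 (neg_le_neg (hlo' p.2.2))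
    exact (abs_sub _ _).trans (add_le_add ((abs_sub _ _).trans (add_le_add h1 h2)) le_rfl)
  have key := autocov_restart_zero_ge (κ₀ := Kernel.id) (π₀ := π₀) (κF := κF ×ₖ κF') hGm hGb
  rw [condMean_pairedWeights h h' hlo hlo' c, autocov_zero, autocov_zero] at key
  exact key

omit [IsMarkovKernel κR] [IsMarkovKernel κR'] [IsMarkovKernel κ₀] in
/-- The stationary mean of the paired difference is the `π₀`-mean of the difference of conditional
means: `∫ D dΠ₂ = ∫ (h − h') dπ₀` (no Crooks structure needed beyond measurability). -/
theorem restart_paired_mean_eq (h : CrooksPair ν₀ ν₁ κF κR s e W)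
    (h' : CrooksPair ν₀ ν₁ κF' κR' s' e' W')
    {Wlo : ℝ} (hlo : ∀ ω, Wlo ≤ W ω) {Wlo' : ℝ} (hlo' : ∀ ω, Wlo' ≤ W' ω) :
    ∫ p, (Real.exp (-W p.2.1) - Real.exp (-W' p.2.2)) ∂(π₀ ⊗ₘ (κF ×ₖ κF'))
      = ∫ x, ((∫ ω, Real.exp (-W ω) ∂(κF x)) - ∫ ω, Real.exp (-W' ω) ∂(κF' x)) ∂π₀ := by
  have hGm : Measurable fun p : Ω × (E × E') => Real.exp (-W p.2.1) - Real.exp (-W' p.2.2) - 0 :=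
    ((Real.measurable_exp.comp (h.measurable_W.comp (measurable_fst.comp measurable_snd)).neg).sub
      (Real.measurable_exp.comp (h'.measurable_W.comp (measurable_snd.comp measurable_snd)).neg)).sub
      measurable_const
  have hGb : ∀ p : Ω × (E × E'), |Real.exp (-W p.2.1) - Real.exp (-W' p.2.2) - 0|
      ≤ Real.exp (-Wlo) + Real.exp (-Wlo') := fun p => by
    have h1 : |Real.exp (-W p.2.1)| ≤ Real.exp (-Wlo) := by
      rw [abs_of_pos (Real.exp_pos _)]; exact Real.exp_le_exp.2 (neg_le_neg (hlo p.2.1))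
    have h2 : |Real.exp (-W' p.2.2)| ≤ Real.exp (-Wlo') := by
      rw [abs_of_pos (Real.exp_pos _)]; exact Real.exp_le_exp.2 (neg_le_neg (hlo' p.2.2))
    rw [sub_zero]
    exact (abs_sub _ _).trans (add_le_add h1 h2)
  have key := integral_condMean (κF := κF ×ₖ κF') (π₀ := π₀) hGm hGb
  have hc := congrFun (condMean_pairedWeights h h' hlo hlo' 0)
  simp only [hc] at key
  simp only [sub_zero] at key
  exact key.symm

omit [IsMarkovKernel κR] [IsMarkovKernel κR'] in
/-- **SAME CONDITIONAL MEAN ⇒ THE GREEN–KUBO VARIANCE OF THE PAIRED DIFFERENCE IS ITS PLAIN SECOND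
MOMENT.**  If `h = h'` pointwise then `∫ D dΠ₂ = 0`, every positive-lag term of the Green–Kubo
series of `D` along `K₂` vanishes, and
`Var_{Π₂}(D) + 2 Σ_k ∫ D̄ · K₂^{k+1} D̄ dΠ₂ = ∫ D² dΠ₂`: the asymptotic variance in the paired CLT
(`Scoring/RestartChainPairedProtocolAgreement.lean`) is the i.i.d. one — however slow the prior
chain. -/
theorem restart_paired_greenKubo_eq_sq_of_condMean_eq (h : CrooksPair ν₀ ν₁ κF κR s e W)
    (h' : CrooksPair ν₀ ν₁ κF' κR' s' e' W')
    {Wlo : ℝ} (hlo : ∀ ω, Wlo ≤ W ω) {Wlo' : ℝ} (hlo' : ∀ ω, Wlo' ≤ W' ω)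
    (hhh' : ∀ x, ∫ ω, Real.exp (-W ω) ∂(κF x) = ∫ ω, Real.exp (-W' ω) ∂(κF' x)) :
    ((∫ p, (Real.exp (-W p.2.1) - Real.exp (-W' p.2.2)
          - ∫ p', (Real.exp (-W p'.2.1) - Real.exp (-W' p'.2.2)) ∂(π₀ ⊗ₘ (κF ×ₖ κF'))) ^ 2
          ∂(π₀ ⊗ₘ (κF ×ₖ κF')))
      + 2 * ∑' k, ∫ p, (Real.exp (-W p.2.1) - Real.exp (-W' p.2.2)
          - ∫ p', (Real.exp (-W p'.2.1) - Real.exp (-W' p'.2.2)) ∂(π₀ ⊗ₘ (κF ×ₖ κF')))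
        * (kop ((Kernel.prodMkRight (E × E') κ₀)
            ⊗ₖ (Kernel.prodMkLeft (Ω × (E × E')) (κF ×ₖ κF'))))^[k + 1]
          (fun p => Real.exp (-W p.2.1) - Real.exp (-W' p.2.2)
            - ∫ p', (Real.exp (-W p'.2.1) - Real.exp (-W' p'.2.2)) ∂(π₀ ⊗ₘ (κF ×ₖ κF'))) p
          ∂(π₀ ⊗ₘ (κF ×ₖ κF')))
      = ∫ p, (Real.exp (-W p.2.1) - Real.exp (-W' p.2.2)) ^ 2 ∂(π₀ ⊗ₘ (κF ×ₖ κF')) := by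
  -- the stationary mean vanishes
  have m0 : ∫ p, (Real.exp (-W p.2.1) - Real.exp (-W' p.2.2)) ∂(π₀ ⊗ₘ (κF ×ₖ κF')) = 0 := by
    rw [restart_paired_mean_eq (κF := κF) (κF' := κF') h h' hlo hlo']
    have hz : (fun x => (∫ ω, Real.exp (-W ω) ∂(κF x)) - ∫ ω, Real.exp (-W' ω) ∂(κF' x))
        = fun _ => (0 : ℝ) := funext fun x => by rw [hhh' x, sub_self]
    rw [hz, integral_zero]
  -- every positive-lag term is an `autocov … (t + 1)`, hence zero
  have hk : ∀ k : ℕ, ∫ p, (Real.exp (-W p.2.1) - Real.exp (-W' p.2.2)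
          - ∫ p', (Real.exp (-W p'.2.1) - Real.exp (-W' p'.2.2)) ∂(π₀ ⊗ₘ (κF ×ₖ κF')))
        * (kop ((Kernel.prodMkRight (E × E') κ₀)
            ⊗ₖ (Kernel.prodMkLeft (Ω × (E × E')) (κF ×ₖ κF'))))^[k + 1]
          (fun p => Real.exp (-W p.2.1) - Real.exp (-W' p.2.2)
            - ∫ p', (Real.exp (-W p'.2.1) - Real.exp (-W' p'.2.2)) ∂(π₀ ⊗ₘ (κF ×ₖ κF'))) p
          ∂(π₀ ⊗ₘ (κF ×ₖ κF')) = 0 := fun k => by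
    have hac := restart_paired_autocov_succ_eq_zero_of_condMean_eq (κ₀ := κ₀) (π₀ := π₀) h h' hlo
      hlo' hhh' k
    rw [m0]
    simp only [sub_zero]
    exact hac
  rw [tsum_congr hk, tsum_zero, mul_zero, add_zero, m0]
  simp only [sub_zero]

omit [IsMarkovKernel κR] in
/-- **THE REPLICA DIFFERENCE HAS THE I.I.D. ASYMPTOTIC VARIANCE**: for two independent replicas of one
protocol per start, the Green–Kubo variance of `e^{−W(ω)} − e^{−W(ω')}` along the joint restart chain
equals its plain second moment `∫ D² dΠ₂` (`= 2 E_{π₀} Var(e^{−W} | x)`, not typed). -/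
theorem restart_replica_greenKubo_eq_sq (h : CrooksPair ν₀ ν₁ κF κR s e W)
    {Wlo : ℝ} (hlo : ∀ ω, Wlo ≤ W ω) :
    ((∫ p, (Real.exp (-W p.2.1) - Real.exp (-W p.2.2)
          - ∫ p', (Real.exp (-W p'.2.1) - Real.exp (-W p'.2.2)) ∂(π₀ ⊗ₘ (κF ×ₖ κF))) ^ 2
          ∂(π₀ ⊗ₘ (κF ×ₖ κF)))
      + 2 * ∑' k, ∫ p, (Real.exp (-W p.2.1) - Real.exp (-W p.2.2)
          - ∫ p', (Real.exp (-W p'.2.1) - Real.exp (-W p'.2.2)) ∂(π₀ ⊗ₘ (κF ×ₖ κF)))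
        * (kop ((Kernel.prodMkRight (E × E) κ₀)
            ⊗ₖ (Kernel.prodMkLeft (Ω × (E × E)) (κF ×ₖ κF))))^[k + 1]
          (fun p => Real.exp (-W p.2.1) - Real.exp (-W p.2.2)
            - ∫ p', (Real.exp (-W p'.2.1) - Real.exp (-W p'.2.2)) ∂(π₀ ⊗ₘ (κF ×ₖ κF))) p
          ∂(π₀ ⊗ₘ (κF ×ₖ κF)))
      = ∫ p, (Real.exp (-W p.2.1) - Real.exp (-W p.2.2)) ^ 2 ∂(π₀ ⊗ₘ (κF ×ₖ κF)) :=
  restart_paired_greenKubo_eq_sq_of_condMean_eq (κ₀ := κ₀) (π₀ := π₀) h h hlo hlo (fun _ => rfl)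

omit [IsMarkovKernel κR] [IsMarkovKernel κF'] [IsMarkovKernel κR'] [IsMarkovKernel κ₀]
  [IsProbabilityMeasure π₀] in
/-- Two replicas from one start: `∫ (g(y.1) − g(y.2))² d(κF ×ₖ κF)(x) = 2 ∫ g² dκF(x) − 2 (∫ g dκF(x))²`
for bounded measurable `g`. -/
theorem integral_sq_sub_replicaProd (x : Ω) {g : E → ℝ} (hg : Measurable g) {C : ℝ}
    (hC : ∀ ω, |g ω| ≤ C) :
    ∫ y, (g y.1 - g y.2) ^ 2 ∂((κF ×ₖ κF) x)
      = 2 * ∫ ω, g ω ^ 2 ∂(κF x) - 2 * (∫ ω, g ω ∂(κF x)) ^ 2 := by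
  have hb2 : ∀ ω, |g ω ^ 2| ≤ C ^ 2 := fun ω => by
    rw [abs_pow]; exact pow_le_pow_left₀ (abs_nonneg _) (hC ω) 2
  have i1 : Integrable (fun y : E × E => g y.1 ^ 2) ((κF ×ₖ κF) x) :=
    integrable_of_bounded _ ((hg.comp measurable_fst).pow_const 2) (C := C ^ 2) fun y => hb2 y.1
  have i2 : Integrable (fun y : E × E => g y.2 ^ 2) ((κF ×ₖ κF) x) :=
    integrable_of_bounded _ ((hg.comp measurable_snd).pow_const 2) (C := C ^ 2) fun y => hb2 y.2
  have i3 : Integrable (fun y : E × E => g y.1 * g y.2) ((κF ×ₖ κF) x) :=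
    integrable_of_bounded _ ((hg.comp measurable_fst).mul (hg.comp measurable_snd)) (C := C * C)
      fun y => by
        rw [abs_mul]
        exact mul_le_mul (hC y.1) (hC y.2) (abs_nonneg _) ((abs_nonneg _).trans (hC y.1))
  have i12 : Integrable (fun y : E × E => g y.1 ^ 2 + g y.2 ^ 2) ((κF ×ₖ κF) x) := i1.add i2
  have i3' : Integrable (fun y : E × E => 2 * (g y.1 * g y.2)) ((κF ×ₖ κF) x) := i3.const_mul 2
  have hexp : (fun y : E × E => (g y.1 - g y.2) ^ 2)
      = fun y => (g y.1 ^ 2 + g y.2 ^ 2) - 2 * (g y.1 * g y.2) := funext fun y => by ring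
  have e1 : ∫ y, g y.1 ^ 2 ∂((κF ×ₖ κF) x) = ∫ ω, g ω ^ 2 ∂(κF x) :=
    integral_fst_kernelProd (κF := κF) (κF' := κF) x (fun ω => g ω ^ 2)
  have e2 : ∫ y, g y.2 ^ 2 ∂((κF ×ₖ κF) x) = ∫ ω, g ω ^ 2 ∂(κF x) :=
    integral_snd_kernelProd (κF := κF) (κF' := κF) x (fun ω => g ω ^ 2)
  have e3 : ∫ y, g y.1 * g y.2 ∂((κF ×ₖ κF) x) = (∫ ω, g ω ∂(κF x)) * ∫ ω, g ω ∂(κF x) := by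
    rw [Kernel.prod_apply]; exact integral_prod_mul (μ := κF x) (ν := κF x) (f := g) (g := g)
  rw [hexp, integral_sub i12 i3', integral_add i1 i2, integral_const_mul, e1, e2, e3]
  ring

omit [IsMarkovKernel κR] [IsMarkovKernel κ₀] in
/-- **THE REPLICA DIFFERENCE'S SECOND MOMENT IS TWICE THE MEAN CONDITIONAL VARIANCE OF THE WEIGHT**:
`∫ (e^{−W(ω)} − e^{−W(ω')})² dΠ₂ = 2 (∫ e^{−2W} dΠ − ∫ h² dπ₀)` (`= 2 E_{π₀} Var(e^{−W} | x)`), the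
protocol-noise part of the S0-D2 error budget — which, by `restart_replica_greenKubo_eq_sq`, the
replica run measures with an i.i.d.-exact error bar. -/
theorem restart_replica_sq_mean (h : CrooksPair ν₀ ν₁ κF κR s e W) {Wlo : ℝ} (hlo : ∀ ω, Wlo ≤ W ω) :
    ∫ p, (Real.exp (-W p.2.1) - Real.exp (-W p.2.2)) ^ 2 ∂(π₀ ⊗ₘ (κF ×ₖ κF))
      = 2 * (∫ q, Real.exp (-W q.2) ^ 2 ∂(π₀ ⊗ₘ κF)
          - ∫ x, (∫ ω, Real.exp (-W ω) ∂(κF x)) ^ 2 ∂π₀) := by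
  have hg : Measurable fun ω : E => Real.exp (-W ω) := Real.measurable_exp.comp h.measurable_W.neg
  have hC : ∀ ω : E, |Real.exp (-W ω)| ≤ Real.exp (-Wlo) := fun ω => by
    rw [abs_of_pos (Real.exp_pos _)]; exact Real.exp_le_exp.2 (neg_le_neg (hlo ω))
  -- the squared difference as an observable of the joint restart law
  have hDm : Measurable fun p : Ω × (E × E) => (Real.exp (-W p.2.1) - Real.exp (-W p.2.2)) ^ 2 :=
    ((hg.comp (measurable_fst.comp measurable_snd)).sub
      (hg.comp (measurable_snd.comp measurable_snd))).pow_const 2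
  have hDb : ∀ p : Ω × (E × E), |(Real.exp (-W p.2.1) - Real.exp (-W p.2.2)) ^ 2|
      ≤ (Real.exp (-Wlo) + Real.exp (-Wlo)) ^ 2 := fun p => by
    rw [abs_pow]
    exact pow_le_pow_left₀ (abs_nonneg _) ((abs_sub _ _).trans (add_le_add (hC p.2.1) (hC p.2.2))) 2
  have key := integral_condMean (κF := κF ×ₖ κF) (π₀ := π₀) hDm hDb
  -- the conditional second moment, start by start
  have hin : ∀ x, ∫ y, (fun p : Ω × (E × E) => (Real.exp (-W p.2.1) - Real.exp (-W p.2.2)) ^ 2) (x, y)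
      ∂((κF ×ₖ κF) x) = 2 * ∫ ω, Real.exp (-W ω) ^ 2 ∂(κF x) - 2 * (∫ ω, Real.exp (-W ω) ∂(κF x)) ^ 2 :=
    fun x => integral_sq_sub_replicaProd (κF := κF) x hg hC
  simp only [hin] at key
  rw [← key]
  -- integrate the two terms over `π₀`
  have hsqm : Measurable fun q : Ω × E => Real.exp (-W q.2) ^ 2 := (hg.comp measurable_snd).pow_const 2
  have hsqb : ∀ q : Ω × E, |Real.exp (-W q.2) ^ 2| ≤ Real.exp (-Wlo) ^ 2 := fun q => by
    rw [abs_pow]; exact pow_le_pow_left₀ (abs_nonneg _) (hC q.2) 2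
  have j1 : Integrable (fun x => ∫ ω, Real.exp (-W ω) ^ 2 ∂(κF x)) π₀ :=
    integrable_of_bounded _ (measurable_condMean (κF := κF) hsqm) (C := Real.exp (-Wlo) ^ 2)
      fun x => abs_condMean_le (κF := κF) hsqb x
  have j2 : Integrable (fun x => (∫ ω, Real.exp (-W ω) ∂(κF x)) ^ 2) π₀ :=
    integrable_of_bounded _ ((measurable_condMean (κF := κF) (hg.comp measurable_snd)).pow_const 2)
      (C := Real.exp (-Wlo) ^ 2) fun x => by
        rw [abs_pow]
        exact pow_le_pow_left₀ (abs_nonneg _) (abs_condMean_le (κF := κF) (fun q => hC q.2) x) 2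
  rw [integral_sub (j1.const_mul 2) (j2.const_mul 2), integral_const_mul, integral_const_mul,
    integral_condMean (κF := κF) (π₀ := π₀) hsqm hsqb]
  ring

end PairedAutocov

end Summit.Ventures.LatticeQCDFlow.Scoring

end
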